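import Literature.NumberTheory.LFunctions.KMVHighDerivativeNonvanishing
import Literature.NumberTheory.LFunctions.AnalyticRanksLandauSiegel
import HarnessLib

/-!
# One central value: the Mellin continuation of `GL2HarmonicFamily` IS the entire `L`-series of
`FamilyNonvanishingLandauSiegel` (Hecke's analytic continuation, Diamond–Shurman Thm. 5.10.2)

Two vocabularies for the family route landed in the tree on 2026-08-26 (cell landau-siegel):
`GL2Family.centralValue f := L^*(f, k/2)` with `L^*(f, s) = (2π)^s Γ(s)⁻¹ ∫₀^∞ f(it) t^{s−1} dt`
(`GL2HarmonicFamily`, a concrete Mellin transform) and `IwaniecSarnak.centralValue f :=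
entireLSeries (cuspCoeff f) (k/2+1) (k/2)` (`FamilyNonvanishingLandauSiegel`, THE entire
continuation of the `L`-series if one exists, chosen classically). This file PROVES they agree —
so every statement typed over either is a statement about the same number — using the tree's
already-proved Hecke theory (`CuspFormLFunctionProofs`: `differentiable_heckeContinuation`,
`heckeContinuation_eq_cuspFormLSeries`):

* `differentiable_cuspFormLStar`: `L^*(f, ·)` is entire (any arithmetic `Γ`);
* `cuspFormLStar_mem_LSeriesContinuations`: on `Γ₀(N)` (and `Γ₁(N)`) it is an element of
  `IwaniecSarnak.LSeriesContinuations (cuspCoeff f) (k/2+1)`, hence that set is non-empty and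
  `IwaniecSarnak.entireLSeries (cuspCoeff f) (k/2+1) = GL2Family.cuspFormLStar f`
  (`entireLSeries_cuspCoeff_eq_cuspFormLStar`) unconditionally;
* `centralValue_eq`: `IwaniecSarnak.centralValue f = GL2Family.centralValue f`;
  `centralDeriv_eq`: `KowalskiMichel2000.centralDeriv f = GL2Family.centralDeriv f`;
* `twistedCentralValue_eq`: for a PRIMITIVE `ψ`, `IwaniecSarnak.twistedCentralValue f ψ =
  GL2Family.twistedCentralValue f ψ` (the twisted `L`-series `∑ ψ(n)a_n n^{−s}` is continued by
  `g(ψ̄)⁻¹ L^*(twistRaw f ψ, s)`, `cuspFormLSeries_twistRaw`), and therefore (quadratic `ψ`)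
  `IwaniecSarnak.twistedCentralValue f ψ = GL2Family.centralValue (charTwist (N m²) f ψ)`: the
  twisted central value of record IS the central value of the honest twisted cusp form.

No named facts. Source of the mathematics: Hecke 1936 / Diamond–Shurman Thm. 5.10.2 (as cited by
the tree lemmas used); Shimura 1971 Prop. 3.64 for the twist.

## References

* F. Diamond, J. Shurman, *A First Course in Modular Forms*, GTM 228, Thm. 5.10.2.
* G. Shimura, *Introduction to the arithmetic theory of automorphic functions* (1971), Prop. 3.64.
-/

noncomputable section

open scoped MatrixGroups Real
open CongruenceSubgroup Complex
open Literature.NumberTheory.EllipticCurves.ModularForms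

namespace Literature.NumberTheory.LFunctions.GL2Family

section Entire

variable {Γ : Subgroup (GL (Fin 2) ℝ)} [Γ.IsArithmetic] {k : ℤ}

/-- **`L^*(f, s) = (2π)^s Γ(s)⁻¹ ∫₀^∞ f(it) t^{s−1} dt` is entire** (Hecke; Diamond–Shurman
Thm. 5.10.2) — the tree's `differentiable_heckeContinuation` in the notation of
`GL2HarmonicFamily`. [cite: DiamondShurman2005, Thm. 5.10.2] -/
theorem differentiable_cuspFormLStar (f : CuspForm Γ k) : Differentiable ℂ (cuspFormLStar f) := by
  have h : cuspFormLStar f =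
      fun s ↦ (2 * Real.pi : ℂ) ^ s * (Complex.Gamma s)⁻¹ * cuspFormMellin f s := by
    funext s; rw [cuspFormLStar, div_eq_mul_inv]
  rw [h]
  exact differentiable_heckeContinuation f

end Entire

section Continuation

variable {N : ℕ} [NeZero N] {k : ℤ}

/-- On `Γ₀(N)`, `L^*(f, ·)` is an entire continuation of the `L`-series `∑ a_n(f) n^{−s}` from
`re s > k/2 + 1`, i.e. an element of `IwaniecSarnak.LSeriesContinuations (cuspCoeff f) (k/2+1)`
(Diamond–Shurman Thm. 5.10.2). [cite: DiamondShurman2005, Thm. 5.10.2] -/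
theorem cuspFormLStar_mem_LSeriesContinuations (f : CuspForm (Gamma0 N) k) :
    cuspFormLStar f ∈ IwaniecSarnak.LSeriesContinuations (cuspCoeff f) ((k : ℝ) / 2 + 1) :=
  ⟨differentiable_cuspFormLStar f, fun _ hs ↦ cuspFormLStar_eq_cuspFormLSeries_gamma0 f hs⟩

/-- On `Γ₁(N)`, likewise. [cite: DiamondShurman2005, Thm. 5.10.2] -/
theorem cuspFormLStar_mem_LSeriesContinuations_gamma1 (f : CuspForm (Gamma1 N) k) :
    cuspFormLStar f ∈ IwaniecSarnak.LSeriesContinuations (cuspCoeff f) ((k : ℝ) / 2 + 1) :=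
  ⟨differentiable_cuspFormLStar f, fun _ hs ↦ cuspFormLStar_eq_cuspFormLSeries_gamma1 f hs⟩

/-- The continuation set of record is NON-EMPTY for every `f ∈ S_k(Γ₀(N))` (so
`IwaniecSarnak.entireLSeries (cuspCoeff f) (k/2+1)` is never the junk branch).
[cite: DiamondShurman2005, Thm. 5.10.2] -/
theorem LSeriesContinuations_cuspCoeff_nonempty (f : CuspForm (Gamma0 N) k) :
    (IwaniecSarnak.LSeriesContinuations (cuspCoeff f) ((k : ℝ) / 2 + 1)).Nonempty :=
  ⟨_, cuspFormLStar_mem_LSeriesContinuations f⟩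

/-- **The entire `L`-series of record IS `L^*(f, ·)`**:
`IwaniecSarnak.entireLSeries (cuspCoeff f) (k/2+1) = GL2Family.cuspFormLStar f` (uniqueness of
the continuation, `IwaniecSarnak.entireLSeries_eq_of_mem`). [cite: DiamondShurman2005, Thm. 5.10.2] -/
theorem entireLSeries_cuspCoeff_eq_cuspFormLStar (f : CuspForm (Gamma0 N) k) :
    IwaniecSarnak.entireLSeries (cuspCoeff f) ((k : ℝ) / 2 + 1) = cuspFormLStar f :=
  IwaniecSarnak.entireLSeries_eq_of_mem (cuspFormLStar_mem_LSeriesContinuations f)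

/-- **One central value**: `IwaniecSarnak.centralValue f = GL2Family.centralValue f`
(`L(f, ½)` in the analytic normalisation, = `L^*(f, k/2)`). [cite: DiamondShurman2005, Thm. 5.10.2] -/
theorem centralValue_eq (f : CuspForm (Gamma0 N) k) :
    IwaniecSarnak.centralValue f = centralValue f := by
  rw [IwaniecSarnak.centralValue, entireLSeries_cuspCoeff_eq_cuspFormLStar, centralValue]

/-- **One central derivative**: `KowalskiMichel2000.centralDeriv f = GL2Family.centralDeriv f`.
[cite: DiamondShurman2005, Thm. 5.10.2] -/
theorem centralDeriv_eq (f : CuspForm (Gamma0 N) k) :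
    KowalskiMichel2000.centralDeriv f = centralDeriv f := by
  rw [KowalskiMichel2000.centralDeriv, entireLSeries_cuspCoeff_eq_cuspFormLStar, centralDeriv]

/-- The entire `L`-series of record of `f ∈ S_k(Γ₀(N))` is differentiable, unconditionally.
[cite: DiamondShurman2005, Thm. 5.10.2] -/
theorem differentiable_entireLSeries_cuspCoeff (f : CuspForm (Gamma0 N) k) :
    Differentiable ℂ (IwaniecSarnak.entireLSeries (cuspCoeff f) ((k : ℝ) / 2 + 1)) := by
  rw [entireLSeries_cuspCoeff_eq_cuspFormLStar]
  exact differentiable_cuspFormLStar f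

end Continuation

section Twisted

variable {N : ℕ} [NeZero N] {k : ℤ} {m : ℕ} [NeZero m]

/-- For a PRIMITIVE `ψ mod m`, the function `s ↦ g(ψ̄)⁻¹ L^*(twistRaw (N m²) f ψ, s)` is an
entire continuation of the twisted `L`-series `∑ ψ(n) a_n(f) n^{−s}` from `re s > k/2 + 1`
(`cuspFormLSeries_twistRaw`: the raw twist has coefficients `ψ(n) g(ψ̄) a_n(f)`, Shimura 1971
Prop. 3.64). [cite: Shimura1971, Prop. 3.64] -/
theorem twistRaw_LStar_mem_LSeriesContinuations (f : CuspForm (Gamma0 N) k)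
    {ψ : DirichletCharacter ℂ m} (hψ : ψ.IsPrimitive) :
    (fun s ↦ (gaussSum ψ⁻¹ (ZMod.stdAddChar (N := m)))⁻¹ *
        cuspFormLStar (twistRaw (N * m ^ 2) (dvd_mul_right N (m ^ 2)) (dvd_mul_left (m ^ 2) N) f ψ) s)
      ∈ IwaniecSarnak.LSeriesContinuations (fun n ↦ ψ n * cuspCoeff f n) ((k : ℝ) / 2 + 1) := by
  have hg : gaussSum ψ⁻¹ (ZMod.stdAddChar (N := m)) ≠ 0 :=
    gaussSum_stdAddChar_ne_zero_of_isPrimitive (isPrimitive_inv hψ)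
  refine ⟨(differentiable_cuspFormLStar _).const_mul _, fun s hs ↦ ?_⟩
  dsimp only
  rw [cuspFormLStar_eq_cuspFormLSeries_gamma1 _ hs, cuspFormLSeries_twistRaw _ _ _ f hψ s,
    ← mul_assoc, inv_mul_cancel₀ hg, one_mul, twistedLSeries]

/-- **One twisted central value** (primitive `ψ`):
`IwaniecSarnak.twistedCentralValue f ψ = GL2Family.twistedCentralValue f ψ`.
[cite: Shimura1971, Prop. 3.64] -/
theorem twistedCentralValue_eq (f : CuspForm (Gamma0 N) k) {ψ : DirichletCharacter ℂ m}
    (hψ : ψ.IsPrimitive) :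
    IwaniecSarnak.twistedCentralValue f ψ = twistedCentralValue f ψ := by
  rw [IwaniecSarnak.twistedCentralValue,
    IwaniecSarnak.entireLSeries_eq_of_mem (twistRaw_LStar_mem_LSeriesContinuations f hψ),
    twistedCentralValue, centralValue]

/-- **The twisted central value of record is the central value of the honest twisted cusp form**
(primitive QUADRATIC `ψ`): `IwaniecSarnak.twistedCentralValue f ψ =
GL2Family.centralValue (charTwist (N m²) f ψ)` with `charTwist f ψ ∈ S_k(Γ₀(N m²))` the tree's
Shimura twist. [cite: Shimura1971, Prop. 3.64] -/
theorem twistedCentralValue_eq_centralValue_charTwist' (f : CuspForm (Gamma0 N) k)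
    {ψ : DirichletCharacter ℂ m} (hψ : ψ.IsQuadratic) (hprim : ψ.IsPrimitive) :
    IwaniecSarnak.twistedCentralValue f ψ =
      centralValue (charTwist (N * m ^ 2) (dvd_mul_right N (m ^ 2)) (dvd_mul_left (m ^ 2) N) hψ f) := by
  rw [twistedCentralValue_eq f hprim, twistedCentralValue_eq_centralValue_charTwist hψ hprim]

end Twisted

/-! ### Append (v2, 2026-08-26): one analytic rank -/

section Rank

variable {q : ℕ} [NeZero q]

/-- **One analytic rank**: the `ℕ∞`-valued `KMV2000.analyticRank q f` (order at the classical centre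
`s = 1` of the entire `L`-series of record, `KMVHighDerivativeNonvanishing`) and the `ℕ`-valued
`GL2Family.analyticRank f` (order of `L^*(f, ·)` at `k/2 = 1`, `AnalyticRanksLandauSiegel`) agree:
`GL2Family.analyticRank f = (KMV2000.analyticRank q f).toNat` — same function
(`entireLSeries_cuspCoeff_eq_cuspFormLStar`), same point. [cite: BuiPrattZaharescu2023, §1 (definition of r_f)] -/
theorem analyticRank_eq_toNat (f : CuspForm (Gamma0 q) 2) :
    analyticRank f = (KMV2000.analyticRank q f).toNat := by
  have h := entireLSeries_cuspCoeff_eq_cuspFormLStar f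
  norm_num at h
  rw [analyticRank, analyticOrderNatAt, KMV2000.analyticRank, h]
  norm_num

end Rank

end Literature.NumberTheory.LFunctions.GL2Family
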